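import Mathlib
import Summits.NavierStokesRegularity.OSWSelfSimilar.SheetNSLineTorusCascadeKernelTwentyPointFiveGeneral
import Summits.NavierStokesRegularity.OSWSelfSimilar.SheetNSLineTorusCascadeKernelGlobalNineteen
import HarnessLib

/-!
# Viscous CLM on the torus (`a = 0`, `σ = 2`): THE DATUM-FREE KERNEL BRACKET `[19, 20.5]·ν` for the sine datum — one citation

HONEST FRAMING (cell ns-blowup GROUP B «PROFILE SEARCH», zone Z3, row Z3-U addendum A-F2 of `HOME/profile/z3/CENSUS-Z3.md`;
human rulings D-0035/D-0074; Z3-TWIN lineage): **1-D MODEL (viscous Constantin–Lax–Majda equation `ω_t = ω Hω + ν ω_xx` on `𝕋`,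
`H = hilbertTransformCircle`); conjunction of kernel theorems, no new estimate; not Euler, not Navier–Stokes; «violates: none — MODEL».
NO script datum.**

* `datumFree_bracket` — for every `ν > 0` and every `c ≥ 0`: if `c < 19ν` the MODEL PDE has a GLOBAL classical `2π`-periodic solution from
  `ω(0,·) = −c sin` (`exists_global_classicalSolution_of_lt_nineteen`, ten exact heads + super-solution tail), and if `c ≥ (41/2)ν` every classical
  solution from that datum has horizon `T < log(206/125)/ν < 1/(2ν)` (`horizon_lt_of_le_twentyPointFive`, aggregate window chain with carry);
* `datumFree_bracket_gen` — the blow-up half for every odd datum `−Σ a_k sin kx` with `a_k ≥ 0`, `a₁ ≥ (41/2)ν` (`horizon_lt_of_le_twentyPointFive_gen`);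
* `log_206_125_lt_half` — `log(206/125) < 1/2`.
The located threshold is `19.7756ν`; the certified script+kernel bracket is `[19.7755478, 19.7766876]·ν`; this file is the DATUM-FREE kernel tier
(eng-5 g12; eng-3 g8/g9 links and synthesis). bears_on: LADDER-NS N5 / zone Z3 (row Z3-U) → N1 linear core. WHAT THIS IS NOT: not NS; no definitions.
-/

namespace Summit.NavierStokesRegularity.OSWSelfSimilar
namespace SheetNSLineTorusCascade

open Finset Real Set

/-- `log(206/125) < 1/2`: `206/125 = 1.648 < Σ_{i≤6} (1/2)^i/i! = 1.6487… ≤ e^{1/2}` (`Real.sum_le_exp_of_nonneg`). [folklore] -/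
theorem log_206_125_lt_half : Real.log (206 / 125) < 1 / 2 := by
  rw [Real.log_lt_iff_lt_exp (by norm_num)]
  have h := Real.sum_le_exp_of_nonneg (x := (1 / 2 : ℝ)) (by norm_num) 7
  simp only [sum_range_succ, sum_range_zero, Nat.factorial] at h
  norm_num at h
  linarith

/-- **THE DATUM-FREE KERNEL BRACKET (sine datum).** For `ν > 0`, `c ≥ 0`: global classical solution from `−c sin x` if `c < 19ν`; no classical
solution on `[0, log(206/125)/ν]` if `c ≥ (41/2)ν`. [new here — MODEL] -/
theorem datumFree_bracket {ν c : ℝ} (hν : 0 < ν) (hc : 0 ≤ c) :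
    (c < 19 * ν → ∃ ω ωt ωx ωxx : ℝ → ℝ → ℝ, (∀ x, ω 0 x = -c * Real.sin x) ∧ ∀ T : ℝ, IsClassicalSolution ν T ω ωt ωx ωxx) ∧
    (41 / 2 * ν ≤ c → ∀ {T : ℝ} {ω ωt ωx ωxx : ℝ → ℝ → ℝ}, IsClassicalSolution ν T ω ωt ωx ωxx →
      (∀ x, ω 0 x = -c * Real.sin x) → T < Real.log (206 / 125) / ν) :=
  ⟨fun hlt => exists_global_classicalSolution_of_lt_nineteen hν hc hlt,
   fun hge _ _ _ _ _ h hω0 => horizon_lt_of_le_twentyPointFive h hω0 hν hge⟩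

/-- **The blow-up half for the general odd class.** A classical `2π`-periodic solution on `[0, T]` whose datum has cascade variables
`coef ω k 0 = a_k ∈ ℝ`, `a_k ≥ 0`, mean zero, `a₁ ≥ (41/2)ν` (`ν > 0`) has `T < log(206/125)/ν < 1/(2ν)`. [new here — MODEL] -/
theorem datumFree_bracket_gen {ν T : ℝ} {ω ωt ωx ωxx : ℝ → ℝ → ℝ} (h : IsClassicalSolution ν T ω ωt ωx ωxx)
    {a : ℕ → ℝ} (hdat : ∀ k : ℕ, coef ω k 0 = ((a k : ℝ) : ℂ)) (ha : ∀ k, 0 ≤ a k) (hmean : mode ω 0 0 = 0)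
    (hν : 0 < ν) (hc : 41 / 2 * ν ≤ a 1) : T < 1 / (2 * ν) := by
  have h1 := horizon_lt_of_le_twentyPointFive_gen h hdat ha hmean hν hc
  have h2 : Real.log (206 / 125) / ν < 1 / (2 * ν) := by
    rw [div_lt_div_iff₀ hν (by positivity)]
    nlinarith [log_206_125_lt_half]
  exact lt_trans h1 h2

end SheetNSLineTorusCascade
end Summit.NavierStokesRegularity.OSWSelfSimilar
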